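import Summits.BirchSwinnertonDyer.BirchSwinnertonDyer.Theorems.AlignedTransportAtTwoBSDOfMainConjectureRankOneAtTwoEulerCharAtTwoKerGImage
import HarnessLib

/-!
# Route `AlignedTransportAtTwo`, crux C3′ `BSDOfMainConjectureRankOneAtTwo` (stmt-BirchSwinnertonDyer-23008), line `birth`,
# the (L) road of the kernel index: THE POINT OBSTRUCTION AS A BI-ADDITIVE MAP `∏_{v∈S} 𝒦_{v,0}[p^∞] →+ (E(K) →+ ℤ/p^k)`
# (independence of the Kummer lift, by isotropy) and its kernel ⊆ the image of Greenberg's embedding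

HONEST FRAMING (cell `bsd-f1-sign2`, attach seat `bsd-line-att-p3` g11 under the C3′ lead lineage `bsd-line-att-p1`;
`--supports stmt-BirchSwinnertonDyer-23008 --as helper`). BSD is NOT proved; C3′ is NOT closed; nothing is asserted. THEOREMS
ONLY (no `def`, no named fact, no `sorry`). Companion of `…EulerCharAtTwoKerGCassels` / `…KerGImage` / `…KerGCount`
(KERINDEX-L-ROAD §3 (a)–(c)).

* §1 `sum_image_inl_union_image_inr` — bookkeeping: a sum over `∞ ∪ S ⊆ Place K` splits as the sum over the infinite places
  plus the sum over `S`.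
* §2 `exists_pointObstructionHom` — for every number field `K : Type`, prime `p`, `ℤ_p`-extension `κ`, finite `S`, level `p^k`
  with `p^n • 𝒦_{v,0}[p^∞] = 0` on `S` (`n ≤ k`), Poitou–Tate family `inv` and Weil pairing `ew`: there is a BI-ADDITIVE
  `B : ∏_{v∈S} 𝒦_{v,0}[p^∞] →+ (E(K) →+ ℤ/p^k)` with `B x P = ∑_{v∈S} inv_v(t_v ∪ₑ loc_v κ_{p^k}(P))` for EVERY family of Kummer
  lifts `t_v ∈ H¹(K_v, E[p^k])` of the `x_v` (two lifts differ by an element of `𝓛_v`, which is isotropic and contains `loc_v κ(P)`: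
  X11b `Relaxation.invWeilPairing_eq_zero_of_mem`).
* §3 `exists_mem_selmerInftyPreimage_of_pointObstructionHom_eq_zero` — with `κ` CYCLOTOMIC, `E(K̄)[p^∞]^{Γ_K} = 0`,
  `S ⊇ {v ∣ p} ∪ {bad}`, `k = n + 1 + e`, `IsPerfect`/`SelmerComplement` and the Ш-exponent hypothesis: **`B x = 0` ⟹ `x = (loc_v y)_v`
  for some `y ∈ A₀`** (`…KerGImage.exists_mem_selmerInftyPreimage_of_pointObstruction` with the lifts of §2 extended by `0` at the
  infinite places).

References: [GreenbergLNM1716] §4 p. 104, Lemma 4.7, Prop. 4.13; [MilneADT2006] I Lemma 6.15; [PoonenRains2012] Prop. 4.8.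
bears_on: stmt-BirchSwinnertonDyer-23008 (helper; closes nothing), stmt-BirchSwinnertonDyer-22298 (attach seat's item; untouched).
-/

set_option autoImplicit false
-- the Theorems namespace of this sub repeats the summit name by design (D-0017 nested layout)
set_option linter.dupNamespace false

noncomputable section

open scoped Classical NumberField

open CategoryTheory Field NumberField IsDedekindDomain Function WeierstrassCurve
open Literature.NumberTheory.EllipticCurves Literature.NumberTheory.EllipticCurves.GreenbergSelmer
open Literature.NumberTheory.GaloisRepresentations
open Literature.NumberTheory.GaloisRepresentations.DiscreteGaloisModule (SelmerStructure unramifiedSubgroup mu MuCarrier)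
open Literature.NumberTheory.GaloisCohomology
open scoped ContRepresentation

namespace Summit.BirchSwinnertonDyer.BirchSwinnertonDyer.Theorems.AlignedTransportAtTwoEulerCharAtTwoKerGObstruction

open Summit.BirchSwinnertonDyer.Rank1Residual.X11b Summit.BirchSwinnertonDyer.Rank1Residual.X11b.KummerPT
open Summit.BirchSwinnertonDyer.Rank1Residual.X11b.LocBridge
open Summit.BirchSwinnertonDyer.Rank1Residual.X11b.Levels
open Summit.BirchSwinnertonDyer.Rank1Residual.X11b.AcSelmer
open Summit.BirchSwinnertonDyer.Rank1Residual.X11b.Relaxation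
open Summit.BirchSwinnertonDyer.Rank1Residual.X11b.KummerDecomp
open Summit.BirchSwinnertonDyer.BirchSwinnertonDyer.Theorems.SignedEC.CasselsPT
open Summit.BirchSwinnertonDyer.BirchSwinnertonDyer.Theorems.AlignedTransportAtTwoEulerCharAtTwoKerGCassels
open Summit.BirchSwinnertonDyer.BirchSwinnertonDyer.Theorems.AlignedTransportAtTwoEulerCharAtTwoKerGImage
open ZpExtension Literature.NumberTheory.EllipticCurves.GreenbergVatsal2000 Summit.BirchSwinnertonDyer.Rank1Residual.X2

/-! ## §1 Sums over `∞ ∪ S` -/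

section Sums

variable {K : Type} [Field K] [NumberField K] {M : Type*} [AddCommMonoid M]

/-- `∑_{v ∈ ∞ ∪ S} f v = ∑_{w ∣ ∞} f w + ∑_{u ∈ S} f u` for the finite set of places `∞ ∪ S ⊆ Place K = InfinitePlace K ⊕ (finite places)`.
[folklore] -/
theorem sum_image_inl_union_image_inr (S : Finset (HeightOneSpectrum (𝓞 K))) (f : Place K → M) :
    ∑ v ∈ (Finset.univ.image Sum.inl ∪ S.image Sum.inr : Finset (Place K)), f v =
      ∑ w : InfinitePlace K, f (Sum.inl w) + ∑ u ∈ S, f (Sum.inr u) := by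
  rw [Finset.sum_union, Finset.sum_image (fun a _ b _ h ↦ Sum.inl_injective h),
    Finset.sum_image (fun a _ b _ h ↦ Sum.inr_injective h)]
  refine Finset.disjoint_left.mpr fun v hv hv' ↦ ?_
  obtain ⟨w, -, rfl⟩ := Finset.mem_image.mp hv
  obtain ⟨u, -, hu⟩ := Finset.mem_image.mp hv'
  exact Sum.inr_ne_inl hu

end Sums

/-! ## §2 The point obstruction as a bi-additive map -/

section Obstruction

variable {K : Type} [Field K] [NumberField K] (W : WeierstrassCurve K) [W.IsElliptic] (p : ℕ) [hp : Fact p.Prime]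
  (κ : ZpExtension K p) (k : ℕ)
  (ew : W.geomTorsion ((p ^ k : ℕ) : ℤ) → W.geomTorsion ((p ^ k : ℕ) : ℤ) → AlgebraicClosure K)
  (hμ : ∀ S T, ew S T ^ (p ^ k) = 1)
  (hadd₁ : ∀ S₁ S₂ T, ew (S₁ + S₂) T = ew S₁ T * ew S₂ T)
  (hadd₂ : ∀ S T₁ T₂, ew S (T₁ + T₂) = ew S T₁ * ew S T₂)
  (hgal : ∀ (σ : absoluteGaloisGroup K) (S T : W.geomTorsion ((p ^ k : ℕ) : ℤ)), σ • ew S T = ew (σ • S) (σ • T))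
  (halt : ∀ T, ew T T = 1)

/-- **Kummer lifts exist.** A class `x_v` of `H¹((Γ_{K_v} → Γ_K)⁻¹(Γ_{K_0}), E(K̄_v))` killed by `p^n`, `n ≤ k`, is the image of a class
`t_v ∈ H¹(K_v, E[p^k])`: `res(κ_v t_v) = res(x_v)` in `H¹((Γ_{K_v} → Γ_K)⁻¹(⊤), E(K̄_v))` (the restrictions are bijections, tree
`bijective_resH1Hom_subgroupIncl`; the local Kummer sequence is onto the `p^k`-torsion, tree
`exists_map_torsionPointsMapIntertwining_eq_of_zsmul_eq_zero`). [cite: SilvermanAEC2009, X.§4 diagram (**)] [cite: GreenbergLNM1716, §2 p. 72] -/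
theorem exists_kummerLift (v : HeightOneSpectrum (𝓞 K)) {n : ℕ} (hnk : n ≤ k)
    (xv : discreteH1 (localSubgroup (κ.layerSubgroup 0) (v.adicCompletion K)) (localPoints W (v.adicCompletion K)))
    (hx : p ^ n • xv = 0) :
    ∃ tv : galoisCohomology ((W.torsionGaloisModule ((p ^ k : ℕ) : ℤ)).toLocal (Sum.inr v)) 1,
      resH1Hom (Literature.NumberTheory.EllipticCurves.subgroupIncl
          (localSubgroup (⊤ : Subgroup (absoluteGaloisGroup K)) (v.adicCompletion K)))
        (AddMonoidHom.id (localPoints W (v.adicCompletion K))) (fun _ _ ↦ rfl)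
        (galoisCohomology.map (W.torsionPointsMapIntertwining ((p ^ k : ℕ) : ℤ) (v.adicCompletion K)) 1 tv) =
      Literature.NumberTheory.EllipticCurves.resOfLe (localPoints W (v.adicCompletion K))
        (localSubgroup_top_le_layerSubgroup_zero κ (v.adicCompletion K)) xv := by
  have hprime : p.Prime := Fact.out
  have hNz : ((p ^ k : ℕ) : ℤ) ≠ 0 := natCast_pow_ne_zero p k
  haveI : CharZero (v.adicCompletion K) :=
    charZero_of_injective_algebraMap (algebraMap K (v.adicCompletion K)).injective
  have hrT := bijective_resH1Hom_subgroupIncl (localPoints W (v.adicCompletion K))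
    (localSubgroup (⊤ : Subgroup (absoluteGaloisGroup K)) (v.adicCompletion K)) mem_localSubgroup_top
  obtain ⟨a, ha⟩ := hrT.2 (Literature.NumberTheory.EllipticCurves.resOfLe (localPoints W (v.adicCompletion K))
    (localSubgroup_top_le_layerSubgroup_zero κ (v.adicCompletion K)) xv)
  have han : ((p ^ k : ℕ) : ℤ) • a = 0 := by
    refine hrT.1 ?_
    rw [map_zsmul, map_zero, ha, natCast_zsmul]
    refine pow_nsmul_eq_zero_of_le p hnk _ ?_
    rw [← map_nsmul, hx, map_zero]
  obtain ⟨b, hb⟩ := W.exists_map_torsionPointsMapIntertwining_eq_of_zsmul_eq_zero (v.adicCompletion K) hNz a han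
  exact ⟨b, by rw [← ha]; exact congrArg _ hb⟩

include halt in
/-- **THE POINT OBSTRUCTION IS A BI-ADDITIVE MAP ON `∏_{v∈S} 𝒦_{v,0}[p^∞]`.** For a finite set `S` of finite places, a level `p^k`
with `p^n • 𝒦_{v,0}[p^∞] = 0` on `S` and `n ≤ k`, a family `inv` of local invariants at level `p^k` and a Weil pairing `ew`, there is a
bi-additive `B : ∏_{v∈S} 𝒦_{v,0}[p^∞] →+ (E(K) →+ ℤ/p^k)` such that **`B x P = ∑_{v∈S} inv_v(t_v ∪ₑ loc_v κ_{p^k}(P))` for EVERY family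
of Kummer lifts `t_v ∈ H¹(K_v, E[p^k])` of the `x_v`** (i.e. with `res(κ_v t_v) = x_v` in `H¹(K_v, E(K̄_v))`): Kummer lifts exist
(`exists_map_torsionPointsMapIntertwining_eq_of_zsmul_eq_zero`), two of them differ by an element of the isotropic `𝓛_v ∋ loc_v κ(P)`
(`invWeilPairing_eq_zero_of_mem`), so the value does not depend on the lift and is additive in `x`. This is the local Tate pairing
`∑_v ⟨x_v, P⟩_v` of Cassels–Poitou–Tate read through the tree's `invWeilPairing`. [cite: GreenbergLNM1716, §4 p. 104, Prop. 4.13]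
[cite: MilneADT2006, Ch. I §6, Lemma 6.15] [cite: PoonenRains2012, Prop. 4.8] -/
theorem exists_pointObstructionHom (S : Finset (HeightOneSpectrum (𝓞 K))) {n : ℕ} (hnk : n ≤ k)
    (hXn : ∀ v ∈ S, ∀ x ∈ W.localTowerKerPrimary κ (v.adicCompletion K) 0, p ^ n • x = 0)
    (inv : LocalInvariants K (p ^ k)) :
    ∃ B : (∀ v : S, W.localTowerKerPrimary κ (v.1.adicCompletion K) 0) →+ (W.toAffine.Point →+ ZMod (p ^ k)),
      ∀ (x : ∀ v : S, W.localTowerKerPrimary κ (v.1.adicCompletion K) 0)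
        (t : Π v : Place K, galoisCohomology ((W.torsionGaloisModule ((p ^ k : ℕ) : ℤ)).toLocal v) 1),
        (∀ v : S,
          resH1Hom (Literature.NumberTheory.EllipticCurves.subgroupIncl
              (localSubgroup (⊤ : Subgroup (absoluteGaloisGroup K)) (v.1.adicCompletion K)))
            (AddMonoidHom.id (localPoints W (v.1.adicCompletion K))) (fun _ _ ↦ rfl)
            (galoisCohomology.map (W.torsionPointsMapIntertwining ((p ^ k : ℕ) : ℤ) (v.1.adicCompletion K)) 1
              (t (Sum.inr v.1))) =
          Literature.NumberTheory.EllipticCurves.resOfLe (localPoints W (v.1.adicCompletion K))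
            (localSubgroup_top_le_layerSubgroup_zero κ (v.1.adicCompletion K))
            ((x v : W.localTowerKerPrimary κ (v.1.adicCompletion K) 0) :
              discreteH1 (localSubgroup (κ.layerSubgroup 0) (v.1.adicCompletion K))
                (localPoints W (v.1.adicCompletion K)))) →
        ∀ P : W.toAffine.Point,
          B x P = ∑ u ∈ S, invWeilPairing W (p ^ k) ew hμ hadd₁ hadd₂ hgal inv (Sum.inr u) (t (Sum.inr u))
            (galoisCohomology.localization (W.torsionGaloisModule ((p ^ k : ℕ) : ℤ)) (Sum.inr u) 1
              (kummerMapTorsion W ((p ^ k : ℕ) : ℤ)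
                (W.zsmul_geomPoints_surjective_holds (natCast_pow_ne_zero p k)) P)) := by
  have hprime : p.Prime := Fact.out
  haveI : NeZero (p ^ k) := ⟨pow_ne_zero k hprime.ne_zero⟩
  have hNz : ((p ^ k : ℕ) : ℤ) ≠ 0 := natCast_pow_ne_zero p k
  -- notation
  let T : S → Type := fun v ↦ W.localTowerKerPrimary κ (v.1.adicCompletion K) 0
  let κP : W.toAffine.Point →+ galoisCohomology (W.torsionGaloisModule ((p ^ k : ℕ) : ℤ)) 1 :=
    kummerMapTorsion W ((p ^ k : ℕ) : ℤ) (W.zsmul_geomPoints_surjective_holds (natCast_pow_ne_zero p k))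
  let loc : ∀ v : Place K, galoisCohomology (W.torsionGaloisModule ((p ^ k : ℕ) : ℤ)) 1 →+
      galoisCohomology ((W.torsionGaloisModule ((p ^ k : ℕ) : ℤ)).toLocal v) 1 :=
    fun v ↦ galoisCohomology.localization (W.torsionGaloisModule ((p ^ k : ℕ) : ℤ)) v 1
  let IW : ∀ v : Place K, galoisCohomology ((W.torsionGaloisModule ((p ^ k : ℕ) : ℤ)).toLocal v) 1 →+
      galoisCohomology ((W.torsionGaloisModule ((p ^ k : ℕ) : ℤ)).toLocal v) 1 →+ ZMod (p ^ k) :=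
    fun v ↦ invWeilPairing W (p ^ k) ew hμ hadd₁ hadd₂ hgal inv v
  -- restriction to the local subgroup `(Γ_{K_v} → Γ_K)⁻¹(⊤)` and the Kummer map `κ_v`, at `v ∈ S`
  let rT : ∀ v : S, galoisCohomology (W.localGaloisModule (v.1.adicCompletion K)) 1 →+
      discreteH1 (localSubgroup (⊤ : Subgroup (absoluteGaloisGroup K)) (v.1.adicCompletion K))
        (localPoints W (v.1.adicCompletion K)) := fun v ↦
    resH1Hom (Literature.NumberTheory.EllipticCurves.subgroupIncl
        (localSubgroup (⊤ : Subgroup (absoluteGaloisGroup K)) (v.1.adicCompletion K)))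
      (AddMonoidHom.id (localPoints W (v.1.adicCompletion K))) (fun _ _ ↦ rfl)
  have hrT : ∀ v : S, Function.Bijective (rT v) := fun v ↦
    bijective_resH1Hom_subgroupIncl (localPoints W (v.1.adicCompletion K))
      (localSubgroup (⊤ : Subgroup (absoluteGaloisGroup K)) (v.1.adicCompletion K)) mem_localSubgroup_top
  let κv : ∀ v : S, galoisCohomology ((W.torsionGaloisModule ((p ^ k : ℕ) : ℤ)).toLocal (Sum.inr v.1)) 1 →+
      galoisCohomology (W.localGaloisModule (v.1.adicCompletion K)) 1 := fun v ↦
    galoisCohomology.map (W.torsionPointsMapIntertwining ((p ^ k : ℕ) : ℤ) (v.1.adicCompletion K)) 1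
  let xT : ∀ v : S, T v → discreteH1 (localSubgroup (⊤ : Subgroup (absoluteGaloisGroup K)) (v.1.adicCompletion K))
      (localPoints W (v.1.adicCompletion K)) := fun v xv ↦
    Literature.NumberTheory.EllipticCurves.resOfLe (localPoints W (v.1.adicCompletion K))
      (localSubgroup_top_le_layerSubgroup_zero κ (v.1.adicCompletion K)) (xv : _)
  have hxT_add : ∀ (v : S) (a b : T v), xT v (a + b) = xT v a + xT v b := fun v a b ↦ by
    change Literature.NumberTheory.EllipticCurves.resOfLe _ _
      (((a + b : W.localTowerKerPrimary κ (v.1.adicCompletion K) 0) :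
        discreteH1 (localSubgroup (κ.layerSubgroup 0) (v.1.adicCompletion K)) (localPoints W (v.1.adicCompletion K)))) = _
    rw [AddSubgroup.coe_add, map_add]
  -- `κ_v(t) ∈ 𝓛_v`-membership is `κ_v t = 0`
  have hmemL : ∀ (v : S) (z : galoisCohomology ((W.torsionGaloisModule ((p ^ k : ℕ) : ℤ)).toLocal (Sum.inr v.1)) 1),
      κv v z = 0 → z ∈ W.kummerSelmerStructure ((p ^ k : ℕ) : ℤ) (Sum.inr v.1) := fun v z hz ↦ hz
  -- two lifts of the same class pair identically with `loc_v κ(P)`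
  have hκL : ∀ (v : Place K) (P : W.toAffine.Point), loc v (κP P) ∈ W.kummerSelmerStructure ((p ^ k : ℕ) : ℤ) v :=
    fun v P ↦ localization_kummerMapTorsion_mem W (p ^ k) v P
  have hwd : ∀ (v : S) (t₁ t₂ : galoisCohomology ((W.torsionGaloisModule ((p ^ k : ℕ) : ℤ)).toLocal (Sum.inr v.1)) 1),
      rT v (κv v t₁) = rT v (κv v t₂) → ∀ P : W.toAffine.Point,
        IW (Sum.inr v.1) t₁ (loc (Sum.inr v.1) (κP P)) = IW (Sum.inr v.1) t₂ (loc (Sum.inr v.1) (κP P)) := by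
    intro v t₁ t₂ h P
    have h12 : t₁ - t₂ ∈ W.kummerSelmerStructure ((p ^ k : ℕ) : ℤ) (Sum.inr v.1) :=
      hmemL v _ (by rw [map_sub, sub_eq_zero]; exact (hrT v).1 h)
    rw [← sub_eq_zero, ← AddMonoidHom.sub_apply, ← map_sub]
    exact invWeilPairing_eq_zero_of_mem W (p ^ k) ew hμ hadd₁ hadd₂ hgal halt inv (Sum.inr v.1) h12 (hκL _ P)
  -- Kummer lifts exist
  have hlift : ∀ (v : S) (xv : T v), ∃ tv : galoisCohomology ((W.torsionGaloisModule ((p ^ k : ℕ) : ℤ)).toLocal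
      (Sum.inr v.1)) 1, rT v (κv v tv) = xT v xv := fun v xv ↦
    exists_kummerLift W p κ k v.1 hnk _ (hXn v.1 v.2 _ xv.2)
  choose tl htl using hlift
  -- the map
  let B₀ : (∀ v : S, T v) → (W.toAffine.Point →+ ZMod (p ^ k)) := fun x ↦
    ∑ v : S, (IW (Sum.inr v.1) (tl v (x v))).comp ((loc (Sum.inr v.1)).comp κP)
  have hB₀ : ∀ x P, B₀ x P = ∑ v : S, IW (Sum.inr v.1) (tl v (x v)) (loc (Sum.inr v.1) (κP P)) := fun x P ↦ by
    simp only [B₀, AddMonoidHom.finsetSum_apply, AddMonoidHom.comp_apply]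
  have hadd : ∀ x x', B₀ (x + x') = B₀ x + B₀ x' := by
    intro x x'
    ext P
    rw [AddMonoidHom.add_apply, hB₀, hB₀, hB₀, ← Finset.sum_add_distrib]
    refine Finset.sum_congr rfl fun v _ ↦ ?_
    rw [← AddMonoidHom.add_apply, ← map_add]
    refine hwd v _ _ ?_ P
    rw [map_add, map_add, htl, htl, htl, Pi.add_apply, hxT_add]
  refine ⟨AddMonoidHom.mk' B₀ hadd, fun x t ht P ↦ ?_⟩
  rw [AddMonoidHom.mk'_apply, hB₀,
    ← Finset.sum_coe_sort S (fun u ↦ invWeilPairing W (p ^ k) ew hμ hadd₁ hadd₂ hgal inv (Sum.inr u) (t (Sum.inr u))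
      (galoisCohomology.localization (W.torsionGaloisModule ((p ^ k : ℕ) : ℤ)) (Sum.inr u) 1
        (kummerMapTorsion W ((p ^ k : ℕ) : ℤ) (W.zsmul_geomPoints_surjective_holds (natCast_pow_ne_zero p k)) P)))]
  refine Finset.sum_congr rfl fun v _ ↦ hwd v _ _ ?_ P
  rw [htl]
  exact (ht v).symm

end Obstruction


/-! ## §3 `ker B` ⊆ the image of Greenberg's embedding -/

section Kernel

variable {K : Type} [Field K] [NumberField K] (W : WeierstrassCurve K) [W.IsElliptic] (p : ℕ) [hp : Fact p.Prime]
  (κ : ZpExtension K p) (k : ℕ)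
  (ew : W.geomTorsion ((p ^ k : ℕ) : ℤ) → W.geomTorsion ((p ^ k : ℕ) : ℤ) → AlgebraicClosure K)
  (hμ : ∀ S T, ew S T ^ (p ^ k) = 1)
  (hadd₁ : ∀ S₁ S₂ T, ew (S₁ + S₂) T = ew S₁ T * ew S₂ T)
  (hadd₂ : ∀ S T₁ T₂, ew S (T₁ + T₂) = ew S T₁ * ew S T₂)
  (hgal : ∀ (σ : absoluteGaloisGroup K) (S T : W.geomTorsion ((p ^ k : ℕ) : ℤ)), σ • ew S T = ew (σ • S) (σ • T))
  (halt : ∀ T, ew T T = 1) (hnondeg : ∀ T, (∀ S, ew S T = 1) → T = 0)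

include halt hnondeg in
/-- **`B x = 0` ⟹ `x` IS A VALUE OF GREENBERG'S EMBEDDING** (CYCLOTOMIC `κ`, `E(K̄)[p^∞]^{Γ_K} = 0`, `S ⊇ {v ∣ p} ∪ {bad}`, `k = n + 1 + e`,
Poitou–Tate family with `IsPerfect`/`SelmerComplement`, Weil pairing, Ш-exponent hypothesis). For ANY map `B` computing the point
obstruction on Kummer lifts (§2), a family `x ∈ ∏_{v∈S} 𝒦_{v,0}[p^∞]` with `B x = 0` is `(loc_v y)_{v∈S}` for some
`y ∈ A₀ = h₀⁻¹(Sel_{p^∞}(E/K_∞))`: choose Kummer lifts on `S` (`exists_kummerLift`), extend by `0` at the infinite places, and apply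
`…KerGImage.exists_mem_selmerInftyPreimage_of_pointObstruction`. [cite: GreenbergLNM1716, §4 p. 104, Lemma 4.7 (pp. 107–108), Prop. 4.13]
[cite: MilneADT2006, Ch. I, Lemma 6.15] -/
theorem exists_mem_selmerInftyPreimage_of_pointObstructionHom_eq_zero (hκ : κ.IsCyclotomic)
    (hE0 : Nat.card (MulAction.fixedPoints (absoluteGaloisGroup K) (W.geomPrimaryTorsion p)) = 1)
    (S : Finset (HeightOneSpectrum (𝓞 K)))
    (hS : ∀ v ∉ S, ((p : ℕ) : 𝓞 K) ∉ v.asIdeal ∧ W.HasGoodReductionAt v)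
    {n e : ℕ} (hk : n + 1 + e = k)
    (hXn : ∀ v ∈ S, ∀ x ∈ W.localTowerKerPrimary κ (v.adicCompletion K) 0, p ^ n • x = 0)
    {inv : LocalInvariants K (p ^ k)} (hperf : inv.IsPerfect) (hcompl : inv.SelmerComplement)
    (hSha : ∀ c : galoisCohomology (W.torsionGaloisModule ((p ^ k : ℕ) : ℤ)) 1,
      (∀ v : HeightOneSpectrum (𝓞 K),
        galoisCohomology.localization (W.torsionGaloisModule ((p ^ k : ℕ) : ℤ)) (Sum.inr v) 1 c ∈
          W.kummerSelmerStructure ((p ^ k : ℕ) : ℤ) (Sum.inr v)) →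
      p ^ e • c ∈ (kummerMapTorsion W ((p ^ k : ℕ) : ℤ)
        (W.zsmul_geomPoints_surjective_holds (natCast_pow_ne_zero p k))).range)
    (B : (∀ v : S, W.localTowerKerPrimary κ (v.1.adicCompletion K) 0) →+ (W.toAffine.Point →+ ZMod (p ^ k)))
    (hB : ∀ (x : ∀ v : S, W.localTowerKerPrimary κ (v.1.adicCompletion K) 0)
        (t : Π v : Place K, galoisCohomology ((W.torsionGaloisModule ((p ^ k : ℕ) : ℤ)).toLocal v) 1),
        (∀ v : S,
          resH1Hom (Literature.NumberTheory.EllipticCurves.subgroupIncl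
              (localSubgroup (⊤ : Subgroup (absoluteGaloisGroup K)) (v.1.adicCompletion K)))
            (AddMonoidHom.id (localPoints W (v.1.adicCompletion K))) (fun _ _ ↦ rfl)
            (galoisCohomology.map (W.torsionPointsMapIntertwining ((p ^ k : ℕ) : ℤ) (v.1.adicCompletion K)) 1
              (t (Sum.inr v.1))) =
          Literature.NumberTheory.EllipticCurves.resOfLe (localPoints W (v.1.adicCompletion K))
            (localSubgroup_top_le_layerSubgroup_zero κ (v.1.adicCompletion K))
            ((x v : W.localTowerKerPrimary κ (v.1.adicCompletion K) 0) :
              discreteH1 (localSubgroup (κ.layerSubgroup 0) (v.1.adicCompletion K))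
                (localPoints W (v.1.adicCompletion K)))) →
        ∀ P : W.toAffine.Point,
          B x P = ∑ u ∈ S, invWeilPairing W (p ^ k) ew hμ hadd₁ hadd₂ hgal inv (Sum.inr u) (t (Sum.inr u))
            (galoisCohomology.localization (W.torsionGaloisModule ((p ^ k : ℕ) : ℤ)) (Sum.inr u) 1
              (kummerMapTorsion W ((p ^ k : ℕ) : ℤ)
                (W.zsmul_geomPoints_surjective_holds (natCast_pow_ne_zero p k)) P)))
    {x : ∀ v : S, W.localTowerKerPrimary κ (v.1.adicCompletion K) 0} (hx : B x = 0) :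
    ∃ y ∈ W.selmerInftyPreimage κ 0, ∀ v : S,
      W.localResOver p (κ.layerSubgroup 0) (v.1.adicCompletion K) y =
        ((x v : W.localTowerKerPrimary κ (v.1.adicCompletion K) 0) :
          discreteH1 (localSubgroup (κ.layerSubgroup 0) (v.1.adicCompletion K)) (localPoints W (v.1.adicCompletion K))) := by
  have hnk : n ≤ k := by omega
  have hxn : ∀ v : S, p ^ n • x v = 0 := fun v ↦
    Subtype.ext (by rw [AddSubgroup.coe_nsmul, hXn v.1 v.2 _ (x v).2]; rfl)
  -- Kummer lifts on `S`, extended by `0`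
  have hlift : ∀ v : S, ∃ tv : galoisCohomology ((W.torsionGaloisModule ((p ^ k : ℕ) : ℤ)).toLocal (Sum.inr v.1)) 1,
      resH1Hom (Literature.NumberTheory.EllipticCurves.subgroupIncl
          (localSubgroup (⊤ : Subgroup (absoluteGaloisGroup K)) (v.1.adicCompletion K)))
        (AddMonoidHom.id (localPoints W (v.1.adicCompletion K))) (fun _ _ ↦ rfl)
        (galoisCohomology.map (W.torsionPointsMapIntertwining ((p ^ k : ℕ) : ℤ) (v.1.adicCompletion K)) 1 tv) =
      Literature.NumberTheory.EllipticCurves.resOfLe (localPoints W (v.1.adicCompletion K))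
        (localSubgroup_top_le_layerSubgroup_zero κ (v.1.adicCompletion K))
        ((x v : W.localTowerKerPrimary κ (v.1.adicCompletion K) 0) : _) := fun v ↦
    exists_kummerLift W p κ k v.1 hnk _ (hXn v.1 v.2 _ (x v).2)
  choose tS htS using hlift
  let t : Π v : Place K, galoisCohomology ((W.torsionGaloisModule ((p ^ k : ℕ) : ℤ)).toLocal v) 1 := fun v ↦
    match v with
    | Sum.inl _ => 0
    | Sum.inr u => if h : u ∈ S then tS ⟨u, h⟩ else 0
  have htinl : ∀ w : InfinitePlace K, t (Sum.inl w) = 0 := fun _ ↦ rfl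
  have htinr : ∀ v : S, t (Sum.inr v.1) = tS v := fun v ↦ by
    change (if h : v.1 ∈ S then tS ⟨v.1, h⟩ else 0) = tS v
    rw [dif_pos v.2]
  have htS' : ∀ v : S,
      resH1Hom (Literature.NumberTheory.EllipticCurves.subgroupIncl
          (localSubgroup (⊤ : Subgroup (absoluteGaloisGroup K)) (v.1.adicCompletion K)))
        (AddMonoidHom.id (localPoints W (v.1.adicCompletion K))) (fun _ _ ↦ rfl)
        (galoisCohomology.map (W.torsionPointsMapIntertwining ((p ^ k : ℕ) : ℤ) (v.1.adicCompletion K)) 1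
          (t (Sum.inr v.1))) =
      Literature.NumberTheory.EllipticCurves.resOfLe (localPoints W (v.1.adicCompletion K))
        (localSubgroup_top_le_layerSubgroup_zero κ (v.1.adicCompletion K))
        ((x v : W.localTowerKerPrimary κ (v.1.adicCompletion K) 0) : _) := fun v ↦ by
    rw [htinr v]; exact htS v
  have hti : ∀ w : InfinitePlace K,
      resH1Hom (Literature.NumberTheory.EllipticCurves.subgroupIncl
          (localSubgroup (⊤ : Subgroup (absoluteGaloisGroup K)) w.Completion))
        (AddMonoidHom.id (localPoints W w.Completion)) (fun _ _ ↦ rfl)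
        (galoisCohomology.map (W.torsionPointsMapIntertwining ((p ^ k : ℕ) : ℤ) w.Completion) 1
          (t (Sum.inl w))) = 0 := fun w ↦ by
    rw [htinl w]
    exact (congrArg _ (map_zero (galoisCohomology.map
      (W.torsionPointsMapIntertwining ((p ^ k : ℕ) : ℤ) w.Completion) 1))).trans (map_zero _)
  -- the obstruction over `∞ ∪ S` is `B x P = 0`
  have hobs : ∀ P : W.toAffine.Point,
      ∑ v ∈ (Finset.univ.image Sum.inl ∪ S.image Sum.inr : Finset (Place K)),
        invWeilPairing W (p ^ k) ew hμ hadd₁ hadd₂ hgal inv v (t v)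
          (galoisCohomology.localization (W.torsionGaloisModule ((p ^ k : ℕ) : ℤ)) v 1
            (kummerMapTorsion W ((p ^ k : ℕ) : ℤ)
              (W.zsmul_geomPoints_surjective_holds (natCast_pow_ne_zero p k)) P)) = 0 := fun P ↦ by
    rw [sum_image_inl_union_image_inr, ← hB x t htS' P, hx, AddMonoidHom.zero_apply, add_zero]
    refine Finset.sum_eq_zero fun w _ ↦ ?_
    rw [htinl w, map_zero, AddMonoidHom.zero_apply]
  exact exists_mem_selmerInftyPreimage_of_pointObstruction W p κ k ew hμ hadd₁ hadd₂ hgal halt hnondeg hκ hE0 S hS x hk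
    hxn hperf hcompl hSha t htS' hti hobs

end Kernel

end Summit.BirchSwinnertonDyer.BirchSwinnertonDyer.Theorems.AlignedTransportAtTwoEulerCharAtTwoKerGObstruction

end
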